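import Mathlib
import HarnessLib
import HarnessLib.Audit
import Summits.QuantumAdvantage.Statement
import Literature.Computability.Cryptography.ClassBQP
import Literature.Computability.Complexity.ProbabilisticClasses
import Literature.Computability.Complexity.Classes
import Literature.Computability.Complexity.BoolEncodings
import HarnessLib.Audit.Status.Attr

/-!
Route: BochnerSampling

DORMANT since 2026-08-22T16:49:22Z (reconciler: no traction for 5.5 d (last activity item-evidence-added at 2026-08-17T04:18:53Z); parked, not closed — `ledger route dormant route-QuantumAdvantage-BochnerSampling --off` to reactivate) — unstaffed, not closed; items shared with open routes are served there. `ledger route dormant <id> --off` reactivates.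

# Route BochnerSampling — Shor is Bochner run backwards — flat Fourier-sampling laws are rigid, so
single-layer advantage is hidden-coset hardness

It suffices to show X = GraphHSPHard: some polynomial-time computable family of functions f_x on
(ℤ/N_x)² (N_x ≥ 2 computable in FP)
hides a GRAPH SUBGROUP H_x = {(d_x t, t)} exactly — f_x(a,b) = f_x(a',b') iff a − d_x b = a' − d_x
b' (mod N_x), an abstract discrete
logarithm with hidden slope d_x — and the bit language {⟨x,i⟩ : bit i of d_x = 1} is not in BPP
(hypothesis-type; instantiated by DLOG in
prime-order subgroups of 𝔽_p^*, f(a,b) = g^a y^(−b), validity P-checkable, malformed x mapped to the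
trivial slope d = 0). Realises card
bochner-sampling-standard-method: the single-query/single-QFT normal form FH₂ SAMPLES the Bochner
(spectral) measure D_f of the
BPP-EVALUABLE collision autocorrelation A_f(Δ) = Pr_y[f(y+Δ) = f(y)]; heavy atoms are classical, and
flat spread laws are rigid
(exactly: FlatLawExact; conjecturally stably: cruxes FlatLawRigidity, FlatLawRigidityCyclic), so
hidden-coset hardness X is the
canonical — not merely a sufficient — source of single-Fourier-layer advantage (crux FH2Necessity,
filed informal after open).
Lean: `∃ (F : List Bool → List Bool) (Nf d : List Bool → ℕ), F ∈
Literature.Computability.Complexity.FP ∧ (fun x => Computability.encodeNat (Nf x)) ∈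
Literature.Computability.Complexity.FP ∧ (∀ x, 2 ≤ Nf x ∧ d x < Nf x) ∧ (∀ x, ∀ a b a' b' : ℕ, a <
Nf x → b < Nf x → a' < Nf x → b' < Nf x → (F (Literature.Computability.Complexity.boolPair x
(Literature.Computability.Complexity.boolPair (Computability.encodeNat a) (Computability.encodeNat
b))) = F (Literature.Computability.Complexity.boolPair x
(Literature.Computability.Complexity.boolPair (Computability.encodeNat a') (Computability.encodeNat
b'))) ↔ ((a : ZMod (Nf x)) - (d x : ZMod (Nf x)) * b = (a' : ZMod (Nf x)) - (d x : ZMod (Nf x)) *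
b'))) ∧ {w : List Bool | ∃ (x : List Bool) (i : ℕ), w = Literature.Computability.Complexity.boolPair
x (Computability.encodeNat i) ∧ (d x).testBit i = true} ∉ Literature.Computability.Complexity.BPP`

## Assembly
Pure logic (proved sorry-free in the planner's Sketch.lean, theorem assembly_holds): GraphHSPHard
supplies F, N, d with the bit language L ∉ BPP;
GraphHSPInBQP puts the same L in Literature.Computability.Cryptography.BQP; ⟨L, ·, ·⟩ witnesses
QuantumAdvantage = ∃ L ∈ BQP, L ∉ BPP. The ranked
cruxes are not on this path: they are the converse programme (single-layer advantage ⇒ hidden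
cosets) that makes X canonical.

Rationale: WHY THIS LINE. The canonical normal form of language-level advantage — one superposed query to a
P-computable f on an abelian register, one QFT, measure,
classical pre/post-processing (Shi2005 §4 FH₂ with FH₁ = BPP and FACT ∈ FH₂; Shor1997, Simon1997,
Kitaev1995) — samples exactly the
spectral probability measure D_f of the positive-definite, [0,1]-valued, BPP-evaluable function A_f
(Bochner / Wiener–Khinchin on a finite
abelian group, item BochnerIdentity; Vandennest2011 for the CT-state version), so "where can FH₂
advantage live?" becomes harmonic analysis of
doubly positive autocorrelations: concentrated laws are classical (SchwarzVandenNest2013 Thm 1 via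
GoldreichLevin1989, KushilevitzMansour1993),
spread laws must be decodable, and FLAT spread laws are rigid — D_f is uniform on its support iff f
separates the cosets of a subgroup
(FlatLawExact, Parseval forces A_f to be {0,1}-valued). Imported area: additive combinatorics /
uncertainty principles (DonohoStark1989 and
Tao2005 equality cases = cosets, GreenSanders2008 quantitative idempotent theorem, GowersEtAl2025 =
PFR over (ℤ/2)^m, Freiman in cyclic groups)
applied to the inverse problem "which level-set partitions have K-flat Fourier-sampling laws". No
prior route owns the FH₂ slice: Shor/AvgCase
carry number-theoretic hypotheses, PadKuperberg a torsor, PromiseLift/CodeCarries promise problems,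
Dequantize the negation; negatives index empty.

RANKED CRUXES. #0 GraphHSPHard (target) — there exist F ∈ FP and N, d with N_x ≥ 2 FP-computable and
d_x < N_x such that (a,b) ↦ F(⟨x,⟨a,b⟩⟩) separates exactly the cosets of the graph subgroup {(d_x t,
t)} of (ℤ/N_x)², and the bit language of d_x is not in BPP (card item X_FS specialised to the
abelian-HSP normal form). (why it might fail: hypothesis-type: it is DLOG-type hardness (implies NP
⊄ BPP-style consequences via SeparationPrerequisites); false if every FP hiding function leaks its
slope classically, which nothing supports but nothing refutes.) [Shor1997, Kitaev1995, Shi2005]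
#2 FlatLawRigidity (crux) — dimension-free flatness rigidity over (ℤ/2)^m (card item R in its flat
form): for every K and δ > 0 there are ε > 0 and L such that for all m, f : (ℤ/2)^m → ℕ and T, if
the Fourier-sampling law D_f puts mass ≥ 1 − ε on T and no point mass above K/|T|, then D_f is
δ-close in ℓ¹ to a mixture of at most L uniform laws on cosets of subgroups. [difficulty: L] (why it
might fail: L ≥ K is forced (t-fold HSP mixtures pile mass t/|W| at the trivial character); unions
of many mutually transverse PROPER cosets with positivity restored by light atoms, or plateaued
partitions with unboundedly many flatness classes, might force L to grow with |T|.)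
[DonohoStark1989, GreenSanders2008, GowersEtAl2025, Tao2012HigherOrderFourier,
SchwarzVandenNest2013]
#3 FlatLawRigidityCyclic (crux) — the same over ℤ/N with shifted Bohr sets of rank ≤ R(K,δ) in place
of cosets (Shor's register ℤ/2^m: D = sinc²/Fejér combs on {c : ‖c r/2^m‖ small}, a rank-1 Bohr set;
subgroups are the radius-0 case). [difficulty: L] (why it might fail: no 2-torsion help: Freiman in
ℤ/N gives coset PROGRESSIONS, and uniform-on-Bohr-set vs uniform-on-progression differ in ℓ¹; the
Bohr rank might have to grow like log|T| rather than depend on (K,δ) only.) [Tao2005,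
GreenSanders2008, Shor1997, Kitaev1995]
#9 BochnerIdentity (support) — B1 of the card as a theorem: Σ_v |Σ_{y ∈ f⁻¹v} ψ(y)|² = Σ_Δ #{y :
f(y+Δ) = f(y)}·ψ(Δ) for every character ψ of a finite abelian group, and the total over ψ is |G|²
(Parseval) — the standard-method law is the Bochner measure of the collision autocorrelation.
[difficulty: provable-now] [Simon1997, deWolf2019, BergChristensenRessel1984]
#9 FlatLawExact (support) — exact rigidity (the card's dictionary B3 as an iff): the
Fourier-sampling law of f : G → ℕ is uniform on its support iff f separates the cosets of a subgroup
H (then the support is H^⊥). Proof: the trivial character lies in the support, so Σ_Δ A_f = |G|/|T|;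
Parseval gives Σ_Δ A_f² = |G|/|T|; 0 ≤ A_f ≤ 1 forces A_f = 1_H. [difficulty: provable-now]
[DonohoStark1989, BergChristensenRessel1984, Simon1997]
#9 GraphHSPInBQP (support) — Shor's two-register standard method over ℤ/N × ℤ/N with an abstract FP
hiding function (Shor1997 §6 verbatim with φ(a − d b) for g^a y^(−b); candidate slopes are
verifiable by f_x(d,1) = f_x(0,0)) puts the bit language of the slope in uniform Clifford+T BQP;
tree precedent isQSolvable_dlog_holds, QFTZModPow. [difficulty: L] [Shor1997, Kitaev1995,
BrassardHoyer1997]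

TWO-LAYER PLAN. Foreseen glued splits (nothing filed now): FlatLawRigidity ⇐ AlmostBinary (K-flat ⇒
Σ A_f(1−A_f) small relative to Σ A_f, Parseval) →
AlmostPeriodsStructured (the level sets {A_f ≥ θ} have doubling O_K(1), hence are O_K(1) cosets by
GowersEtAl2025) → FlatLawRigidity;
FlatLawRigidityCyclic ⇐ the same two steps with Freiman–Bohr in ℤ/N; FH2Necessity ⇐ (flat calls ⇒
coset sampling, by the rigidity cruxes) →
(non-flat spread calls are BPP-simulable) → FH2Necessity.

KILL CRITERIA. FlatLawRigidity refuted by an explicit dimension-growing family ⇒ the refuting family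
is a new kind of flat FH₂ law: re-type rank 2 with its
structure class (one --restate) or close `refuted:FlatLawRigidity` if no bounded class fits —
informative either way. FH2Necessity refuted by a
white-box single-layer witness outside coset/Bohr/quadric sampling ⇒ close (the card's prediction
fails). GraphHSPHard is hypothesis-type and
never staffed; GraphHSPInBQP failing AS TYPED (uniformity/encodings) ⇒ re-type, not a kill. Route
Shor being conditional-complete does not
moot this route: its earned content is the rigidity programme, not the bridge.

NOT DECOMPOSED YET. The general finite-abelian statement (cosets + Bohr sets + affine QUADRICS over
𝔽_q^d, q odd — ChildsSchulmanVazirani2007's hidden-radius law is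
flat on quadric classes); the instantiation lemma DLOG-hardness ⇒ GraphHSPHard (shares AvgCase's
DLOGHalf machinery); the relativized
calibration "stateless Fourier-sampling calls cannot search" (BBBV/Zalka-type); the (ℤ/2)^m
white-box Simon target (no candidate instances —
whether a poly-size circuit can hide a linear subspace as an exact period group is itself open);
quantitative (polynomial) dependence of
(ε, L) on (K, δ).

CHEAPEST FALSIFIER. For FlatLawRigidity: take D = uniform on a union of t pairwise-transverse PROPER
cosets ψ_i + W_i of (ℤ/2)^m plus the lightest atom at 0
that makes A = Ď nonnegative, and check (by hand or a kit enumeration for m ≤ 12) whether such a D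
is realised as D_f by a level-set
partition with K = O(1) while t grows — one afternoon. Planner checks already done by hand: t-fold
HSP mixtures force K ≥ t (consistent);
𝔽₂-quadratic forms give coset laws (stabilizer supports are affine); Hamming weight gives a non-flat
Krawtchouk-graded law; bent functions
give ½δ₀ + ½·uniform — no counterexample found. For the whole line: a lookup whether "flat output
law ⇔ hidden subgroup" (FlatLawExact) is
already in print would downgrade novelty, not kill.

NUMBERS. FH₁ = BPP, FACT ∈ FH₂ (Shi2005 §4); Shor's order-finding law: r peaks of mass ≈ 1/r each,
max atom ≈ (4/π²)/r, (K,ε)-flat with K·ε = O(1)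
(sinc² tails); Simon: exactly 1-flat on H^⊥; SchwarzVandenNest2013 Thm 1: ε-approximately t-sparse
QFT laws of CT states are samplable in
poly(n, t, 1/ε). Items at open: 7 typed + 1 informal crux (FH2Necessity) + 2 definition requests.

DEFINITION REQUESTS. BPPFS (Literature/Computability/QuantumComplexity): BPP with a STATELESS
standard-method Fourier-sampling functional oracle — query = (Boolean
circuit for f : {0,1}^m → {0,1}^*, register tag (ℤ/2)^m or ℤ/2^m), answer = one sample (v, c) of
measure-f-register-then-QFT (Shi2005 §4, one
level of FH); with its calibration theorem BPPFS ⊆ BQP. ApproxHiddenCosetOracle (same topic): given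
the same query, returns a sample of the
coset-mixture (resp. Bohr-mixture) law attached to f by FlatLawRigidity / FlatLawRigidityCyclic when
D_f is (K,ε)-flat, else ⊥. Both needed
to type FH2Necessity: BPP^FS ⊆ BPP^ApproxHiddenCoset.

Novelty: Searches (2026-08-15): `lit search --hybrid "hidden subgroup problem Fourier sampling distribution
characterization converse uniform coset state"` (12 docs, only deWolf2019 HSP chapter relevant:
forward direction); `lit vsearch "positive definite function … set where it equals 1 is a subgroup
…"` (BergChristensenRessel1984 §4.1.6 and general PD texts only); `lit search --source zbmath
"uncertainty principle finite abelian groups stability"` (1 irrelevant); `lit galaxy search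
"uncertainty principle finite abelian groups" --star all` (0 substring hits); OpenAlex/S2/arXiv
rate-limited (429) this session; `lit read arXiv:0705.2784` pp. 3–6 (hidden radius law); Crossref
`lit cite` for DonohoStark1989, Tao2005, GreenSanders2008, ChildsSchulmanVazirani2007,
GowersEtAl2025; plus the card's audit NOVELTY-AUDIT-10 (READ arXiv:1310.6749 pp. 1–8, Shi2005 §4).
Nearest prior art found: Shi2005 §4 (the class FH₂, FACT ∈ FH₂) and Shor1997 §6 / Kitaev1995 (the
bridge — claimed known); SchwarzVandenNest2013 Thm 1 + Vandennest2011 (dequantization of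
concentrated laws — used, not claimed); DonohoStark1989 / Tao2005 (uncertainty equality cases =
cosets), GreenSanders2008 (few-valued idempotents = coset ring), GowersEtAl2025 (PFR);
ChildsSchulmanVazirani2007 (quadric-flat decodable laws in odd characteristic — the known
obstruction that fixes the scope of the typed cruxes).
Delta: the iff characterisation FlatLawExact of exact abelian-HSP instances by flatness of their
output law (two-line Parseva  [refs: 0705.2784, 1310.6749, BergChristensenRessel1984, DonohoStark1989, Tao2005, GreenSanders2008, ChildsSchulmanVazirani2007, GowersEtAl2025, Shi2005, Shor1997, Kitaev1995, SchwarzVandenNest2013, Vandennest2011]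

Barriers (technique_class: additive-combinatorics, structure, conditional-bridge): - technique_class: additive-combinatorics, structure, conditional-bridge
- Literature.Barriers.QuantumAdvantage.SeparationPrerequisites: it does not evade it; applies in
full to the target GraphHSPHard (with GraphHSPInBQP it yields the summit, hence PP ⊄ BPP etc.) —
GraphHSPHard is hypothesis-type and never staffed; the earned items are finite harmonic-analysis
statements implying no class separation.
- Literature.Barriers.QuantumAdvantage.Relativization: the rigidity statements concern arbitrary
functions on finite abelian groups and hold verbatim for oracles (relativize harmlessly, like the
Simon/Shor upper bounds); FH2Necessity's relativized reading is consistent with the oracle world as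
far as checked (Simon/Shor/BV are coset instances; hidden SHIFT families are invisible to
single-layer sampling since A_(g(·+s)) = A_g; ChildsSchulmanVazirani2007's hidden-radius law over
𝔽_q^d, q odd, is flat on affine quadric classes — the named exception); the bridge X → summit
relativizes harmlessly; no technique for the summit itself is claimed.
- Literature.Barriers.QuantumAdvantage.TotalFunctionSpeedupLimit: consistent and explanatory — for
unstructured total f the law D_f has no K-flat component on a small T, so the programme predicts no
FH₂ advantage there, matching bealsEtAl2001_thm54; the route only concerns hidden-coset families.
- Literature.Barriers.QuantumAdvantage.RandomOracleMethod: consistent — relative to a random oracle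
collision autocorrelations are δ-like and laws nea

History (route lifecycle, newest last):
- 2026-08-16T04:14:49Z · AUTO-CRUX (backfill): GraphHSPHard — hypotheses of the deciding theorem that nothing in the route derives are cruxes (operator:999:1085951)
- 2026-08-22T16:49:22Z · DORMANT — reconciler: no traction for 5.5 d (last activity item-evidence-added at 2026-08-17T04:18:53Z); parked, not closed — `ledger route dormant route-QuantumAdvantage (operator:999:3437366)

sub-problem: QuantumAdvantage · status: dormant · opened planner-plancard-QuantumAdvantage-QuantumAdva-829b2eaf-0 2026-08-15T11:06:27Z · rev 3 · ledger route-QuantumAdvantage-BochnerSampling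
GENERATED by the gate from the ledger (D-0016/17). Provers cite these decls: `theorem foo : Summit.QuantumAdvantage.QuantumAdvantage.Theses.BochnerSampling.<Decl> := …` in Summits/QuantumAdvantage/QuantumAdvantage/Theorems/<Name>.lean.
-/

namespace Summit.QuantumAdvantage.QuantumAdvantage.Theses.BochnerSampling

open scoped BigOperators Topology Manifold Classical MeasureTheory ProbabilityTheory Matrix InnerProductSpace ComplexConjugate ContinuousMap
open Filter Set Function TopologicalSpace MeasureTheory

attribute [summit_statement] _root_.QuantumAdvantage

open Literature.QuantumAdvantage

/-- item stmt-QuantumAdvantage-2621 · crux (kind.auto-crux: conjecture-grade) · rank 0 · open · by planner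
why it might fail: hypothesis-type: it is DLOG-type hardness (implies NP ⊄ BPP-style consequences via SeparationPrerequisites); false if every FP hiding function leaks its slope classically, which nothing supports but nothing refutes.
sources: Shor1997, Kitaev1995, Shi2005
[target] there exist F ∈ FP and N, d with N_x ≥ 2 FP-computable and d_x < N_x such that (a,b) ↦
F(⟨x,⟨a,b⟩⟩) separates exactly the cosets of the graph subgroup {(d_x t, t)} of (ℤ/N_x)², and the
bit language of d_x is not in BPP (card item X_FS specialised to the abelian-HSP normal form). -/
@[route_item "route-QuantumAdvantage-BochnerSampling", crux]
def GraphHSPHard : Prop :=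
  ∃ (F : List Bool → List Bool) (Nf d : List Bool → ℕ), F ∈ Literature.Computability.Complexity.FP ∧ (fun x => Computability.encodeNat (Nf x)) ∈ Literature.Computability.Complexity.FP ∧ (∀ x, 2 ≤ Nf x ∧ d x < Nf x) ∧ (∀ x, ∀ a b a' b' : ℕ, a < Nf x → b < Nf x → a' < Nf x → b' < Nf x → (F (Literature.Computability.Complexity.boolPair x (Literature.Computability.Complexity.boolPair (Computability.encodeNat a) (Computability.encodeNat b))) = F (Literature.Computability.Complexity.boolPair x (Literature.Computability.Complexity.boolPair (Computability.encodeNat a') (Computability.encodeNat b'))) ↔ ((a : ZMod (Nf x)) - (d x : ZMod (Nf x)) * b = (a' : ZMod (Nf x)) - (d x : ZMod (Nf x)) * b'))) ∧ {w : List Bool | ∃ (x : List Bool) (i : ℕ), w = Literature.Computability.Complexity.boolPair x (Computability.encodeNat i) ∧ (d x).testBit i = true} ∉ Literature.Computability.Complexity.BPP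

/-- item stmt-QuantumAdvantage-2622 · crux · rank 2 · open · by planner
why it might fail: L ≥ K is forced (t-fold HSP mixtures pile mass t/|W| at the trivial character); unions of many mutually transverse PROPER cosets with positivity restored by light atoms, or plateaued partitions with unboundedly many flatness classes, might force L to grow with |T|.
sources: DonohoStark1989, GreenSanders2008, GowersEtAl2025, Tao2012HigherOrderFourier, SchwarzVandenNest2013
[crux] dimension-free flatness rigidity over (ℤ/2)^m (card item R in its flat form): for every K and
δ > 0 there are ε > 0 and L such that for all m, f : (ℤ/2)^m → ℕ and T, if the Fourier-sampling law
D_f puts mass ≥ 1 − ε on T and no point mass above K/|T|, then D_f is δ-close in ℓ¹ to a mixture of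
at most L uniform laws on cosets of subgroups. [difficulty: L] -/
@[route_item "route-QuantumAdvantage-BochnerSampling"]
def FlatLawRigidity : Prop :=
  ∀ (K : ℕ) (δ : ℝ), 0 < δ → ∃ ε : ℝ, 0 < ε ∧ ∃ L : ℕ, ∀ (m : ℕ) (f : (Fin m → ZMod 2) → ℕ) (T : Finset (Fin m → ZMod 2)), (1 - ε ≤ ∑ c ∈ T, (∑ y : Fin m → ZMod 2, ∑ y' : Fin m → ZMod 2, if f y = f y' then (-1 : ℝ) ^ (∑ i, (c i * (y i - y' i)).val) else 0) / (4 : ℝ) ^ m) → (∀ c : Fin m → ZMod 2, (∑ y : Fin m → ZMod 2, ∑ y' : Fin m → ZMod 2, if f y = f y' then (-1 : ℝ) ^ (∑ i, (c i * (y i - y' i)).val) else 0) / (4 : ℝ) ^ m ≤ K / (T.card : ℝ)) → ∃ (w : Fin L → ℝ) (c₀ : Fin L → (Fin m → ZMod 2)) (W : Fin L → AddSubgroup (Fin m → ZMod 2)), (∀ i, 0 ≤ w i) ∧ ∑ i, w i = 1 ∧ ∑ c : Fin m → ZMod 2, |(∑ y : Fin m → ZMod 2, ∑ y' : Fin m →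 ZMod 2, if f y = f y' then (-1 : ℝ) ^ (∑ i, (c i * (y i - y' i)).val) else 0) / (4 : ℝ) ^ m - ∑ i, w i * (if c - c₀ i ∈ W i then (1 : ℝ) / Nat.card (W i) else 0)| ≤ δ

/-- item stmt-QuantumAdvantage-2623 · crux · rank 3 · open · by planner
why it might fail: no 2-torsion help: Freiman in ℤ/N gives coset PROGRESSIONS, and uniform-on-Bohr-set vs uniform-on-progression differ in ℓ¹; the Bohr rank might have to grow like log|T| rather than depend on (K,δ) only.
sources: Tao2005, GreenSanders2008, Shor1997, Kitaev1995
[crux] the same over ℤ/N with shifted Bohr sets of rank ≤ R(K,δ) in place of cosets (Shor's register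
ℤ/2^m: D = sinc²/Fejér combs on {c : ‖c r/2^m‖ small}, a rank-1 Bohr set; subgroups are the radius-0
case). [difficulty: L] -/
@[route_item "route-QuantumAdvantage-BochnerSampling"]
def FlatLawRigidityCyclic : Prop :=
  ∀ (K : ℕ) (δ : ℝ), 0 < δ → ∃ ε : ℝ, 0 < ε ∧ ∃ L R : ℕ, ∀ (N : ℕ) [NeZero N] (f : ZMod N → ℕ) (T : Finset (ZMod N)), (1 - ε ≤ ∑ c ∈ T, (∑ y : ZMod N, ∑ y' : ZMod N, if f y = f y' then Real.cos (2 * Real.pi * (c * (y - y')).val / N) else 0) / (N : ℝ) ^ 2) → (∀ c : ZMod N, (∑ y : ZMod N, ∑ y' : ZMod N, if f y = f y' then Real.cos (2 * Real.pi * (c * (y - y')).val / N) else 0) / (N : ℝ) ^ 2 ≤ K / (T.card : ℝ)) → ∃ (w : Fin L → ℝ) (c₀ : Fin L → ZMod N) (Γ : Fin L → Finset (ZMod N)) (ρ : Fin L → ℝ), (∀ i, 0 ≤ w i) ∧ ∑ i, w i = 1 ∧ (∀ i, (Γ i).card ≤ R) ∧ ∑ c : ZMod N, |(∑ y : ZMod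 N, ∑ y' : ZMod N, if f y = f y' then Real.cos (2 * Real.pi * (c * (y - y')).val / N) else 0) / (N : ℝ) ^ 2 - ∑ i, w i * (if ∀ γ ∈ Γ i, |((γ * (c - c₀ i)).valMinAbs : ℝ)| ≤ ρ i * N then (1 : ℝ) / (Finset.univ.filter fun c' : ZMod N => ∀ γ ∈ Γ i, |((γ * (c' - c₀ i)).valMinAbs : ℝ)| ≤ ρ i * N).card else 0)| ≤ δ

-- item stmt-QuantumAdvantage-2688 · crux · rank 4 · open · by planner — informal only, no Lean statement yet:
--   [crux] FH2Necessity (card items B5/B6, the converse programme): every language decided by a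
--   probabilistic polynomial-time machine with STATELESS standard-method Fourier-sampling calls (query =
--   a Boolean circuit for f : {0,1}^m -> {0,1}^* and a register tag (Z/2)^m or Z/2^m; answer = one
--   sample (v,c): measure the f-register, QFT the query register, measure; Shi2005 sec. 4, one level of
--   FH) is decided by such a machine whose calls are answered instead by the APPROXIMATE-HIDDEN-COSET
--   oracle, which returns a sample of the coset-mixture (resp. shifted-Bohr-mixture) law attached to f
--   by FlatLawRigid

/-- item stmt-QuantumAdvantage-2624 · support · rank 9 · open · by planner
sources: Simon1997, deWolf2019, BergChristensenRessel1984
[support] B1 of the card as a theorem: Σ_v |Σ_{y ∈ f⁻¹v} ψ(y)|² = Σ_Δ #{y : f(y+Δ) = f(y)}·ψ(Δ) for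
every character ψ of a finite abelian group, and the total over ψ is |G|² (Parseval) — the
standard-method law is the Bochner measure of the collision autocorrelation. [difficulty:
provable-now] -/
@[route_item "route-QuantumAdvantage-BochnerSampling"]
def BochnerIdentity : Prop :=
  ∀ (G : Type) [AddCommGroup G] [Fintype G] [DecidableEq G] (f : G → ℕ) (ψ : AddChar G ℂ), ((∑ v ∈ Finset.univ.image f, ‖∑ y ∈ Finset.univ.filter (fun y => f y = v), ψ y‖ ^ 2 : ℝ) : ℂ) = ∑ Δ : G, (Fintype.card {y : G // f (y + Δ) = f y} : ℂ) * ψ Δ ∧ (∑ φ : AddChar G ℂ, ∑ v ∈ Finset.univ.image f, ‖∑ y ∈ Finset.univ.filter (fun y => f y = v), φ y‖ ^ 2 : ℝ) = (Fintype.card G : ℝ) ^ 2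

/-- item stmt-QuantumAdvantage-2625 · support · rank 9 · open · by planner
sources: DonohoStark1989, BergChristensenRessel1984, Simon1997
[support] exact rigidity (the card's dictionary B3 as an iff): the Fourier-sampling law of f : G → ℕ
is uniform on its support iff f separates the cosets of a subgroup H (then the support is H^⊥).
Proof: the trivial character lies in the support, so Σ_Δ A_f = |G|/|T|; Parseval gives Σ_Δ A_f² =
|G|/|T|; 0 ≤ A_f ≤ 1 forces A_f = 1_H. [difficulty: provable-now] -/
@[route_item "route-QuantumAdvantage-BochnerSampling"]
def FlatLawExact : Prop :=
  ∀ (G : Type) [AddCommGroup G] [Fintype G] [DecidableEq G] (f : G → ℕ), (∃ T : Finset (AddChar G ℂ), T.Nonempty ∧ ∀ ψ : AddChar G ℂ, (∑ y : G, ∑ y' : G, if f y = f y' then (ψ (y - y')).re else 0) / (Fintype.card G : ℝ) ^ 2 = if ψ ∈ T then (1 : ℝ) / T.card else 0) ↔ (∃ H : AddSubgroup G, ∀ y y' : G, f y = f y' ↔ y - y' ∈ H)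

/-- item stmt-QuantumAdvantage-2626 · support · rank 9 · open · by planner
sources: Shor1997, Kitaev1995, BrassardHoyer1997
[support] Shor's two-register standard method over ℤ/N × ℤ/N with an abstract FP hiding function
(Shor1997 §6 verbatim with φ(a − d b) for g^a y^(−b); candidate slopes are verifiable by f_x(d,1) =
f_x(0,0)) puts the bit language of the slope in uniform Clifford+T BQP; tree precedent
isQSolvable_dlog_holds, QFTZModPow. [difficulty: L] -/
@[route_item "route-QuantumAdvantage-BochnerSampling", crux]
def GraphHSPInBQP : Prop :=
  ∀ (F : List Bool → List Bool) (Nf d : List Bool → ℕ), F ∈ Literature.Computability.Complexity.FP → (fun x => Computability.encodeNat (Nf x)) ∈ Literature.Computability.Complexity.FP → (∀ x, 2 ≤ Nf x ∧ d x < Nf x) → (∀ x, ∀ a b a' b' : ℕ, a < Nf x → b < Nf x → a' < Nf x → b' < Nf x → (F (Literature.Computability.Complexity.boolPair x (Literature.Computability.Complexity.boolPair (Computability.encodeNat a) (Computability.encodeNat b))) = F (Literature.Computability.Complexity.boolPair x (Literature.Computability.Complexity.boolPair (Computability.encodeNat a') (Computability.encodeNat b'))) ↔ ((a : ZMod (Nf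 x)) - (d x : ZMod (Nf x)) * b = (a' : ZMod (Nf x)) - (d x : ZMod (Nf x)) * b'))) → {w : List Bool | ∃ (x : List Bool) (i : ℕ), w = Literature.Computability.Complexity.boolPair x (Computability.encodeNat i) ∧ (d x).testBit i = true} ∈ Literature.Computability.Cryptography.BQP

/-- item stmt-QuantumAdvantage-2627 · assembly · rank 1 · open · by planner
sources: Shor1997, Shi2005
[assembly] GraphHSPInBQP → GraphHSPHard → QuantumAdvantage. -/
@[route_item "route-QuantumAdvantage-BochnerSampling"]
def Assembly : Prop :=
  GraphHSPInBQP → GraphHSPHard → QuantumAdvantage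

/-! D-0027 §2.1 — DECIDING THEOREM (planner-authored via `route open/edit --closes-file`; by planner-rbadge-QuantumAdvantage-BochnerSamplin-adc458ac-g2-0 2026-08-15T16:07:22Z):
its hypotheses are this route's items and its conclusion the sub-problem Statement (glue_lint), and it elaborates with this file. -/

@[closes "route-QuantumAdvantage-BochnerSampling"] theorem closes (h₁ : GraphHSPInBQP) (h₂ : GraphHSPHard) : QuantumAdvantage := by
  obtain ⟨F, Nf, d, hF, hN, hNd, hsep, hnot⟩ := h₂
  exact ⟨_, h₁ F Nf d hF hN hNd hsep, hnot⟩

end Summit.QuantumAdvantage.QuantumAdvantage.Theses.BochnerSampling
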